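import Literature.AlgebraicGeometry.Motives.ProjectiveSpaceHyperplaneSection
import Literature.AlgebraicGeometry.Motives.CubicHypersurfaceLinearSubspaces
import Mathlib.FieldTheory.IsAlgClosed.Basic
import HarnessLib

/-!
# Linear subspaces are not torsion in the Chow groups of `ℙᴺ`; Mboro's Cor. 2.9 from inputs (a), (b)

For a field `K` and the projective space `ℙᴺ_K = Proj K[x₀, …, x_N]` (`projectiveSpace N K`), the
class of an `r`-plane `Π = V₊(L₁, …, L_{N-r})` (its generic point `w`, `IsLinearSubspacePoint r N
(𝟙 ℙᴺ) w`, `Motives/LinearSubspacesGenerateChow`) is not torsion in `CH_r(ℙᴺ_K)`: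

* `IsLinearSubspacePoint.zsmul_primeCycle_notMem_ratTrivial_of_id` — **`m • [Π] ∉ Rat_r(ℙᴺ)` for
  `m ≠ 0`** (`K` infinite). Proof by induction on `r` with the hyperplane-section operation
  `c₁(𝒪(1)) ∩ -` (Fulton, *Intersection Theory*, §2.5 with Cor. 2.4.1; in the tree
  `ProjSpace.interCycle_mem_ratTrivial_of_linEquiv_hyperplane`,
  `Motives/ProjectiveSpaceHyperplaneSection`): for a coordinate hyperplane `V₊(x_l) ⊅ Π`,
  `V₊(x_l) · (m • [Π]) = (m a) • [Π ∩ V₊(x_l)]` with `a ≥ 1` and `Π ∩ V₊(x_l)` an `(r-1)`-plane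
  (`ProjSpace.exists_primeInter_formDivisor_eq_smul_of_isLinearSubspacePoint`,
  `Motives/ProjectiveSpaceLinearSubspaceSection`), and for `r = 0` a closed point of the proper
  variety `ℙᴺ` is not torsion in `CH₀` (degree,
  `eq_zero_of_zsmul_primeCycle_mem_ratTrivial_of_height_eq_zero`). This is the easy half of
  `CH_r(ℙᴺ) = ℤ · [Π]` (Fulton, Example 1.9.3 / Prop. 1.8 give generation; §2.5 / Example 2.5.1
  give `deg (H^{r} ∩ [Π]) = 1`, whence freeness).
* `Mboro2018_chowTwo_cubic_of_inputs` — **[Mboro2018] Cor. 2.9 reduced to its two inputs on the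
  cubic `X`**: input (c') of `Mboro2018_chowTwo_cubic_of_inputs_and_projectiveSpace`
  (`Motives/CubicHypersurfaceLinearSubspaces`) is discharged by the above (`r = 2`), leaving
  (a) (`n ≥ 7`: every irreducible surface of a smooth cubic `n`-fold is rationally equivalent to an
  integral combination of planes — Mboro Prop. 1.4 + Thm. 2.8) and (b) (`n ≥ 9`: any two planes of
  `X` are rationally equivalent — Debarre–Manivel). Neither (a) nor (b) is proved here.

Everything in this file is proved; no named facts.

## References

* R. Mboro, *Remarks on the `CH₂` of cubic hypersurfaces*, Geom. Dedicata 200 (2019) 1–25 =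
  arXiv:1701.04488, Cor. 2.9 and its proof (p. 12). [Mboro2018]
* W. Fulton, *Intersection Theory*, 2nd ed., Springer (1998): §1.9 and Example 1.9.3, Cor. 2.4.1
  (p. 37), §2.5 and Example 2.5.1 (p. 41), Def. 1.4. [Fulton1998]
-/

noncomputable section

open CategoryTheory AlgebraicGeometry Order

universe u

namespace Literature.AlgebraicGeometry.Motives

/-! ### `r`-planes are not torsion in `CH_r(ℙᴺ)` -/

/-- **The class of an `r`-plane is not torsion in `CH_r(ℙᴺ_K)`** (`K` infinite): for an `r`-plane
point `w` of `ℙᴺ` (w.r.t. `𝟙 ℙᴺ`) and `m ≠ 0`, `m • [closure {w}] ∉ Rat_r(ℙᴺ)`. Induction on `r`: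
cut with a coordinate hyperplane `V₊(x_l)` not containing the plane (Fulton, Cor. 2.4.1 / §2.5 on
`ℙᴺ`: `ProjSpace.interCycle_mem_ratTrivial_of_linEquiv_hyperplane`), which gives a positive multiple
of an `(r-1)`-plane (`ProjSpace.exists_primeInter_formDivisor_eq_smul_of_isLinearSubspacePoint`);
for `r = 0` use the degree (`eq_zero_of_zsmul_primeCycle_mem_ratTrivial_of_height_eq_zero`).
[cite: Fulton1998, Cor. 2.4.1 (p. 37), Example 2.5.1 (p. 41) and Definition 1.4] -/
theorem IsLinearSubspacePoint.zsmul_primeCycle_notMem_ratTrivial_of_id {K : Type u} [Field K]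
    [Infinite K] {N : ℕ} :
    ∀ {r : ℕ} {w : ↥(projectiveSpace N K).left},
      IsLinearSubspacePoint r N (𝟙 (projectiveSpace N K)) w → ∀ {m : ℤ}, m ≠ 0 →
        m • primeCycle w ∉ ratTrivial (projectiveSpace N K).left r := by
  intro r
  induction r with
  | zero =>
    intro w hw m hm hmem
    exact hm (eq_zero_of_zsmul_primeCycle_mem_ratTrivial_of_height_eq_zero (projectiveSpace N K)
      (p := w) (by simpa using hw.1) hmem)
  | succ r ih =>
    intro w hw m hm hmem
    -- a coordinate hyperplane not containing the plane
    obtain ⟨l, hl⟩ := ProjSpace.exists_X_notMem (d := N) (K := K) w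
    have hX : (MvPolynomial.X l : MvPolynomial (Fin (N + 1)) K) ∈ Segre.grading (Fin (N + 1)) K 1 :=
      Segre.X_mem K l
    have hX0 : (MvPolynomial.X l : MvPolynomial (Fin (N + 1)) K) ≠ 0 := MvPolynomial.X_ne_zero l
    obtain ⟨w', a, hw', ha, hprime⟩ :=
      ProjSpace.exists_primeInter_formDivisor_eq_smul_of_isLinearSubspacePoint (Nat.succ_le_succ
        (Nat.zero_le r)) hw hX hX0 hl
    -- cut the rational equivalence with `V₊(x_l) ∼ H`
    have hcut := ProjSpace.interCycle_mem_ratTrivial_of_linEquiv_hyperplane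
      (ProjSpace.hyperplane_linEquiv_formDivisor hX hX0) hmem
    rw [CartierDivisor.interCycle_zsmul, CartierDivisor.interCycle_primeCycle, hprime, smul_smul] at hcut
    rw [Nat.succ_sub_one] at hw'
    exact ih hw' (mul_ne_zero hm ha.ne') hcut

/-- **Input (c') of `Mboro2018_chowTwo_cubic_of_inputs_and_projectiveSpace`**: over an infinite
field, no positive multiple of the class of a `2`-plane of `ℙᴺ` is rationally equivalent to zero.
[cite: Fulton1998, Cor. 2.4.1 (p. 37) and Example 2.5.1 (p. 41)] -/
theorem IsLinearSubspacePoint.nsmul_primeCycle_notMem_ratTrivial_of_id {K : Type u} [Field K]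
    [Infinite K] {N : ℕ} {w : ↥(projectiveSpace N K).left}
    (hw : IsLinearSubspacePoint 2 N (𝟙 (projectiveSpace N K)) w) {m : ℕ} (hm : 0 < m) :
    m • primeCycle w ∉ ratTrivial (projectiveSpace N K).left 2 := by
  have h := hw.zsmul_primeCycle_notMem_ratTrivial_of_id (m := (m : ℤ)) (by exact_mod_cast hm.ne')
  rwa [natCast_zsmul] at h

/-! ### Mboro's Cor. 2.9 from the two inputs (a), (b) on the cubic -/

/-- **[Mboro2018] Cor. 2.9 from two cycle-level inputs on the cubic `X`.** Refines
`Mboro2018_chowTwo_cubic_of_inputs_and_projectiveSpace` (`Motives/CubicHypersurfaceLinearSubspaces`):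
its input (c') (non-torsion of planes modulo rational equivalence on projective space) is the
theorem `IsLinearSubspacePoint.nsmul_primeCycle_notMem_ratTrivial_of_id` (an algebraically closed
field is infinite). The remaining inputs: (a) (`n ≥ 7`) every irreducible surface of `X` is
rationally equivalent to an integral combination of planes (Prop. 1.4 + Thm. 2.8 in print: osculating
lines / Tsen–Lang, and `CH₁(F(X))` generated by lines via rational curves on the Fano variety);
(b) (`n ≥ 9`) any two planes of `X` are rationally equivalent (Debarre–Manivel, `CH₀(F₂(X)) = ℤ`,
through `F(F(X)) ≅ ℙ(ℰ₃|_{F₂(X)})`). Neither (a) nor (b) is proved here.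
[cite: Mboro2018, Cor. 2.9 and its proof (arXiv:1701.04488 p. 12)] -/
theorem Mboro2018_chowTwo_cubic_of_inputs
    (ha : ∀ ⦃k : Type u⦄ [Field k] [IsAlgClosed k] [CharZero k] (n : ℕ) ⦃X : SchemeOver k⦄
      (F : MvPolynomial (Fin (n + 1 + 1)) k) (i : X ⟶ projectiveSpace (n + 1) k),
      letI := MvPolynomial.gradedAlgebra (σ := Fin (n + 1 + 1)) (R := k)
      IsSmoothProjective n X → F.IsHomogeneous 3 → Irreducible F → IsClosedImmersion i.left →
        Set.range i.left.base =
          ProjectiveSpectrum.zeroLocus (MvPolynomial.homogeneousSubmodule (Fin (n + 1 + 1)) k)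
            {F} →
          7 ≤ n → ∀ z : ↥X.left, Order.height z = 2 →
            ∃ (s : Finset ↥X.left) (w : ↥X.left → ℤ),
              (∀ y ∈ s, IsLinearSubspacePoint 2 (n + 1) i y) ∧
                IsRationallyEquivalent (primeCycle z) (∑ y ∈ s, w y • primeCycle y) 2)
    (hb : ∀ ⦃k : Type u⦄ [Field k] [IsAlgClosed k] [CharZero k] (n : ℕ) ⦃X : SchemeOver k⦄
      (F : MvPolynomial (Fin (n + 1 + 1)) k) (i : X ⟶ projectiveSpace (n + 1) k),
      letI := MvPolynomial.gradedAlgebra (σ := Fin (n + 1 + 1)) (R := k)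
      IsSmoothProjective n X → F.IsHomogeneous 3 → Irreducible F → IsClosedImmersion i.left →
        Set.range i.left.base =
          ProjectiveSpectrum.zeroLocus (MvPolynomial.homogeneousSubmodule (Fin (n + 1 + 1)) k)
            {F} →
          9 ≤ n → ∀ ⦃z z' : ↥X.left⦄, IsLinearSubspacePoint 2 (n + 1) i z →
            IsLinearSubspacePoint 2 (n + 1) i z' →
              IsRationallyEquivalent (primeCycle z) (primeCycle z') 2) :
    Mboro2018_chowTwo_cubic.{u} := by
  refine Mboro2018_chowTwo_cubic_of_inputs_and_projectiveSpace ha hb ?_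
  intro k _ _ _ N w hw m hm
  haveI : Infinite k := IsAlgClosed.instInfinite
  exact hw.nsmul_primeCycle_notMem_ratTrivial_of_id hm

end Literature.AlgebraicGeometry.Motives

end
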